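import Literature.MathematicalPhysics.KineticTheory.TaggedSphereSpectralGap

/-!
# Negative type of the hard-sphere flux kernel (stub `stub_negType` of the line `Sketch`,
# crux `InformationPercolationEngine.SpectralContractionR`)

For an integrable `φ : ℝ³ → ℝ` with finite first moment and total mass zero,
`∫∫ ν(v - w) φ(v) φ(w) dv dw ≤ 0`, where `ν(v - w) = ∫_{S²} ((v - w)·ω)₊ dσ(ω)` is the sphere
integral of the hard-sphere kernel (`= lorentzLossRate (v - w) = π |v - w|`). This is Schoenberg's
negative type of the Euclidean distance, proved here by SLICING, which needs no facts about the
sphere beyond the finiteness of its surface measure: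

* Fubini puts `dσ(ω)` outside (`0 ≤ ((v - w)·ω)₊ ≤ |v| + |w|`), so it suffices that for every
  fixed direction `e` the sliced form `∫∫ ((v - w)·e)₊ φ(v) φ(w)` is `≤ 0` (`slice_nonpos`);
* for fixed `e`, `(s - t)₊ = λ(Ioc t s) = ∫ 1{t < r} 1{r ≤ s} dr` with `s = v·e`, `t = w·e`, so by
  Fubini again the sliced form is `∫ F(r) G(r) dr` with `F(r) = ∫_{v·e ≥ r} φ` and
  `G(r) = ∫_{w·e < r} φ = ∫ φ - F(r) = -F(r)` (mass zero; the two half-spaces partition `ℝ³`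
  exactly, no null-hyperplane argument is needed), i.e. `-∫ F² ≤ 0`.
-/

noncomputable section
open MeasureTheory Metric Real Set Filter Topology
open scoped InnerProductSpace ENNReal
namespace Summit.AtomisticToContinuum.HydrodynamicLimit.Theorems.SpectralContractionRLine.NegType
open Literature.MathematicalPhysics.KineticTheory
open Literature.Analysis.FunctionSpaces (maxwellianBeta maxwellianBeta_one maxwellianBeta_pos)
open TaggedSphereDiffusion (collisionFrequency)

/-- Integrability of the sliced pair integrand `((v - w)·e)₊ φ(v) ψ(w)` on `ℝ³ × ℝ³` for
integrable `φ, ψ` with finite first moments: `((v - w)·e)₊ ≤ |e| (|v| + |w|)`. [folklore] -/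
theorem integrable_posPart_inner_mul (e : V3) {φ ψ : V3 → ℝ} (hφ : Integrable φ)
    (hφ1 : Integrable fun v => ‖v‖ * φ v) (hψ : Integrable ψ)
    (hψ1 : Integrable fun v => ‖v‖ * ψ v) :
    Integrable (fun p : V3 × V3 => max ⟪p.1 - p.2, e⟫_ℝ 0 * (φ p.1 * ψ p.2))
      (volume.prod volume) := by
  have hb : Integrable (fun p : V3 × V3 =>
      ‖‖p.1‖ * φ p.1‖ * ‖ψ p.2‖ + ‖φ p.1‖ * ‖‖p.2‖ * ψ p.2‖) (volume.prod volume) :=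
    (hφ1.norm.mul_prod hψ.norm).add (hφ.norm.mul_prod hψ1.norm)
  refine Integrable.mono' (hb.const_mul ‖e‖) ?_ (Eventually.of_forall fun p => ?_)
  · exact (by fun_prop : Continuous fun p : V3 × V3 =>
      max ⟪p.1 - p.2, e⟫_ℝ 0).aestronglyMeasurable.mul
        (hφ.aestronglyMeasurable.comp_fst.mul hψ.aestronglyMeasurable.comp_snd)
  · rw [norm_mul, norm_mul, Real.norm_of_nonneg (le_max_right _ _)]
    simp only [norm_mul, norm_norm]
    have h1 : max ⟪p.1 - p.2, e⟫_ℝ 0 ≤ ‖e‖ * (‖p.1‖ + ‖p.2‖) := by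
      refine max_le ?_ (by positivity)
      calc ⟪p.1 - p.2, e⟫_ℝ ≤ ‖p.1 - p.2‖ * ‖e‖ := real_inner_le_norm _ _
        _ ≤ (‖p.1‖ + ‖p.2‖) * ‖e‖ := mul_le_mul_of_nonneg_right (norm_sub_le _ _) (norm_nonneg _)
        _ = ‖e‖ * (‖p.1‖ + ‖p.2‖) := mul_comm _ _
    calc max ⟪p.1 - p.2, e⟫_ℝ 0 * (‖φ p.1‖ * ‖ψ p.2‖)
        ≤ ‖e‖ * (‖p.1‖ + ‖p.2‖) * (‖φ p.1‖ * ‖ψ p.2‖) :=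
          mul_le_mul_of_nonneg_right h1 (by positivity)
      _ = ‖e‖ * (‖p.1‖ * ‖φ p.1‖ * ‖ψ p.2‖ + ‖φ p.1‖ * (‖p.2‖ * ‖ψ p.2‖)) := by ring

/-- **The sliced form is nonpositive.** For a fixed direction `e ∈ ℝ³` and an integrable `φ` with
finite first moment and total mass zero, `∫∫ ((v - w)·e)₊ φ(v) φ(w) dv dw ≤ 0`: writing
`((v - w)·e)₊ = ∫ 1{w·e < r ≤ v·e} dr`, Fubini gives `∫ F(r) (-F(r)) dr` with
`F(r) = ∫_{v·e ≥ r} φ` (mass zero). [folklore] -/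
theorem slice_nonpos (e : V3) {φ : V3 → ℝ} (hφ : Integrable φ)
    (hφ1 : Integrable fun v => ‖v‖ * φ v) (hφ0 : ∫ v, φ v = 0) :
    ∫ p : V3 × V3, max ⟪p.1 - p.2, e⟫_ℝ 0 * (φ p.1 * φ p.2) ∂(volume.prod volume) ≤ 0 := by
  have hs : Measurable fun x : V3 => ⟪x, e⟫_ℝ := (continuous_id.inner continuous_const).measurable
  -- the slicing set `{w·e < r ≤ v·e}` and the slicing integrand
  have hTm : MeasurableSet {q : (V3 × V3) × ℝ | ⟪q.1.2, e⟫_ℝ < q.2 ∧ q.2 ≤ ⟪q.1.1, e⟫_ℝ} := by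
    have hm1 : Measurable fun q : (V3 × V3) × ℝ => ⟪q.1.2, e⟫_ℝ := hs.comp measurable_fst.snd
    have hm2 : Measurable fun q : (V3 × V3) × ℝ => ⟪q.1.1, e⟫_ℝ := hs.comp measurable_fst.fst
    exact (measurableSet_lt hm1 measurable_snd).inter (measurableSet_le measurable_snd hm2)
  obtain ⟨G, hG⟩ : ∃ G : (V3 × V3) × ℝ → ℝ,
      G = {q : (V3 × V3) × ℝ | ⟪q.1.2, e⟫_ℝ < q.2 ∧ q.2 ≤ ⟪q.1.1, e⟫_ℝ}.indicator
        fun q => φ q.1.1 * φ q.1.2 := ⟨_, rfl⟩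
  -- its two pointwise forms
  have hG1 : ∀ (p : V3 × V3) (r : ℝ),
      G (p, r) = (Ioc ⟪p.2, e⟫_ℝ ⟪p.1, e⟫_ℝ).indicator (fun _ => φ p.1 * φ p.2) r := by
    intro p r
    simp only [hG, Set.indicator_apply, mem_setOf_eq, mem_Ioc]
  have hG2 : ∀ (v w : V3) (r : ℝ), G ((v, w), r) =
      {v : V3 | r ≤ ⟪v, e⟫_ℝ}.indicator φ v * {w : V3 | ⟪w, e⟫_ℝ < r}.indicator φ w := by
    intro v w r
    simp only [hG, Set.indicator_apply, mem_setOf_eq]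
    by_cases h1 : r ≤ ⟪v, e⟫_ℝ <;> by_cases h2 : ⟪w, e⟫_ℝ < r <;> simp [h1, h2]
  -- the `r`-integrals of `G` and `‖G‖`
  have hGint : ∀ p : V3 × V3, ∫ r, G (p, r) = max ⟪p.1 - p.2, e⟫_ℝ 0 * (φ p.1 * φ p.2) := by
    intro p
    simp_rw [hG1]
    rw [integral_indicator_const _ measurableSet_Ioc, Real.volume_real_Ioc, inner_sub_left,
      smul_eq_mul]
  have hGnorm : ∀ p : V3 × V3,
      ∫ r, ‖G (p, r)‖ = max ⟪p.1 - p.2, e⟫_ℝ 0 * (‖φ p.1‖ * ‖φ p.2‖) := by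
    intro p
    simp_rw [hG1, norm_indicator_eq_indicator_norm, norm_mul]
    rw [integral_indicator_const _ measurableSet_Ioc, Real.volume_real_Ioc, inner_sub_left,
      smul_eq_mul]
  -- integrability of `G` on `(ℝ³ × ℝ³) × ℝ`
  have hGm : AEStronglyMeasurable G ((volume.prod volume).prod volume) := by
    rw [hG]
    exact ((hφ.aestronglyMeasurable.comp_fst.mul
      hφ.aestronglyMeasurable.comp_snd).comp_fst).indicator hTm
  have hGi : Integrable G ((volume.prod volume).prod volume) := by
    refine (integrable_prod_iff hGm).mpr ⟨Eventually.of_forall fun p => ?_, ?_⟩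
    · simp_rw [hG1]
      exact (integrableOn_const (by rw [Real.volume_Ioc]; exact ENNReal.ofReal_ne_top)
        ).integrable_indicator measurableSet_Ioc
    · simp_rw [hGnorm]
      have h1 : Integrable fun v : V3 => ‖v‖ * ‖φ v‖ := by
        simpa only [norm_mul, norm_norm] using hφ1.norm
      exact integrable_posPart_inner_mul e hφ.norm h1 hφ.norm h1
  -- mass zero: `∫_{w·e < r} φ = -∫_{v·e ≥ r} φ`
  have hA : ∀ r : ℝ, MeasurableSet {v : V3 | r ≤ ⟪v, e⟫_ℝ} := fun r =>
    measurableSet_le measurable_const hs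
  have hB : ∀ r : ℝ, MeasurableSet {w : V3 | ⟪w, e⟫_ℝ < r} := fun r =>
    measurableSet_lt hs measurable_const
  have hF : ∀ r : ℝ, ∫ w, {w : V3 | ⟪w, e⟫_ℝ < r}.indicator φ w =
      -∫ v, {v : V3 | r ≤ ⟪v, e⟫_ℝ}.indicator φ v := by
    intro r
    have hc : {w : V3 | ⟪w, e⟫_ℝ < r}ᶜ = {v : V3 | r ≤ ⟪v, e⟫_ℝ} := by
      ext v; simp [not_lt]
    have hadd := integral_add_compl (hB r) hφ
    rw [hc, hφ0, ← integral_indicator (hB r), ← integral_indicator (hA r)] at hadd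
    linarith
  -- the computation
  calc ∫ p : V3 × V3, max ⟪p.1 - p.2, e⟫_ℝ 0 * (φ p.1 * φ p.2) ∂(volume.prod volume)
      = ∫ p : V3 × V3, (∫ r, G (p, r)) ∂(volume.prod volume) :=
        integral_congr_ae (Eventually.of_forall fun p => (hGint p).symm)
    _ = ∫ r, (∫ p : V3 × V3, G (p, r) ∂(volume.prod volume)) :=
        integral_integral_swap (f := fun p r => G (p, r)) hGi
    _ = ∫ r, (∫ v, {v : V3 | r ≤ ⟪v, e⟫_ℝ}.indicator φ v) *
          ∫ w, {w : V3 | ⟪w, e⟫_ℝ < r}.indicator φ w := by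
        congr 1
        funext r
        have hr : (fun p : V3 × V3 => G (p, r)) = fun p =>
            {v : V3 | r ≤ ⟪v, e⟫_ℝ}.indicator φ p.1 * {w : V3 | ⟪w, e⟫_ℝ < r}.indicator φ p.2 := by
          funext p; exact hG2 p.1 p.2 r
        rw [hr, integral_prod _ ((hφ.indicator (hA r)).mul_prod (hφ.indicator (hB r)))]
        simp_rw [integral_const_mul, integral_mul_const]
    _ = ∫ r, -((∫ v, {v : V3 | r ≤ ⟪v, e⟫_ℝ}.indicator φ v) ^ 2) := by
        congr 1
        funext r
        rw [hF r]
        ring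
    _ ≤ 0 := integral_nonpos fun r => neg_nonpos.mpr (sq_nonneg _)

/-- Integrability of the flux pair integrand `((v - w)·ω)₊ φ(v) φ(w)` on `(ℝ³ × ℝ³) × S²`
(`0 ≤ ((v - w)·ω)₊ ≤ |v| + |w|`, `σ(S²) < ∞`). [folklore] -/
theorem integrable_hardSphereKernel_mul {φ : V3 → ℝ} (hφ : Integrable φ)
    (hφ1 : Integrable fun v => ‖v‖ * φ v) :
    Integrable (Function.uncurry fun (p : V3 × V3) (ω : sphere (0 : V3) 1) =>
      hardSphereKernel p ω * (φ p.1 * φ p.2)) ((volume.prod volume).prod sphereMeasure) := by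
  have hb : Integrable (fun p : V3 × V3 =>
      ‖‖p.1‖ * φ p.1‖ * ‖φ p.2‖ + ‖φ p.1‖ * ‖‖p.2‖ * φ p.2‖) (volume.prod volume) :=
    (hφ1.norm.mul_prod hφ.norm).add (hφ.norm.mul_prod hφ1.norm)
  refine Integrable.mono' (hb.mul_prod (integrable_const (1 : ℝ))) ?_
    (Eventually.of_forall fun q => ?_)
  · exact continuous_hardSphereKernel.aestronglyMeasurable.mul
      ((hφ.aestronglyMeasurable.comp_fst.mul hφ.aestronglyMeasurable.comp_snd).comp_fst)
  · obtain ⟨⟨v, w⟩, ω⟩ := q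
    simp only [Function.uncurry_apply_pair, norm_mul, norm_norm, mul_one]
    rw [Real.norm_of_nonneg (hardSphereKernel_nonneg _ _)]
    calc hardSphereKernel (v, w) ω * (‖φ v‖ * ‖φ w‖) ≤ (‖v‖ + ‖w‖) * (‖φ v‖ * ‖φ w‖) :=
          mul_le_mul_of_nonneg_right (hardSphereKernel_le v w ω) (by positivity)
      _ = ‖v‖ * ‖φ v‖ * ‖φ w‖ + ‖φ v‖ * (‖w‖ * ‖φ w‖) := by ring

/-- **Negative type of the flux kernel** (registered stub `stub_negType` of the line `Sketch` for
the crux `InformationPercolationEngine.SpectralContractionR`). For an integrable `φ : ℝ³ → ℝ` with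
finite first moment and total mass zero,
`∫∫ (∫_{S²} ((v - w)·ω)₊ dσ(ω)) φ(v) φ(w) dv dw ≤ 0` — Schoenberg's negative type of
`ν(v - w) = π |v - w|`, by slicing: Fubini puts `dσ(ω)` outside and each slice is `≤ 0`
(`slice_nonpos`). [folklore] -/
theorem stub_negType : ∀ φ : V3 → ℝ, Integrable φ → Integrable (fun v => ‖v‖ * φ v) →
    ∫ v, φ v = 0 →
    ∫ v, ∫ w, (∫ ω, hardSphereKernel (v, w) ω ∂sphereMeasure) * (φ v * φ w) ≤ 0 := by
  intro φ hφ hφ1 hφ0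
  have hH := integrable_hardSphereKernel_mul hφ hφ1
  have h1 : (fun v => ∫ w, (∫ ω, hardSphereKernel (v, w) ω ∂sphereMeasure) * (φ v * φ w)) =
      fun v => ∫ w, ∫ ω, hardSphereKernel (v, w) ω * (φ v * φ w) ∂sphereMeasure := by
    funext v
    congr 1
    funext w
    exact (integral_mul_const _ _).symm
  have h2 : ∫ v, ∫ w, ∫ ω, hardSphereKernel (v, w) ω * (φ v * φ w) ∂sphereMeasure =
      ∫ p : V3 × V3, ∫ ω, hardSphereKernel p ω * (φ p.1 * φ p.2) ∂sphereMeasure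
        ∂(volume.prod volume) :=
    (integral_prod (fun p : V3 × V3 => ∫ ω, hardSphereKernel p ω * (φ p.1 * φ p.2) ∂sphereMeasure)
      hH.integral_prod_left).symm
  rw [h1, h2, integral_integral_swap hH]
  refine integral_nonpos fun ω => ?_
  exact slice_nonpos (ω : V3) hφ hφ1 hφ0

end Summit.AtomisticToContinuum.HydrodynamicLimit.Theorems.SpectralContractionRLine.NegType

end
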